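import Summits.BirchSwinnertonDyer.Rank1Residual.Additive.KatoDescentKMCImpReadingRowRealizable
import Literature.NumberTheory.EllipticCurves.AnalyticRankModularityProofs
import HarnessLib

set_option autoImplicit false

/-!
# Crux 19223 `CccOneLawOnTypeIstarZero` BY NAME with the route's support item `PublishedFactsInert` CUT TO WHAT THE
# Kato–Perrin-Riou line CONSUMES: Gross–Zagier I.(7.3), Mazur's Manin-constant theorem and the separate entire-`L` input
# LEAVE the K8 KPR cone — the `GrossZagier1986_thm_I_7_3`-free, `mazur_not_dvd_maninConstant_of_odd`-free and (keyed to
# modularity) `hasEntireLFunction_rat`-free composition heads for a v10 `kato_perrin_riou_istar` skeleton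
# (seat `bsd-cm-prr-ty1` g21, cell `bsd-cm`; theorems only: no definition, no named fact, no instance, no `sorry`; this file
# registers nothing — the planner touches the skeleton)

Part 57 of the seat's kernel cut (crux stmt-BirchSwinnertonDyer-19223, registered line `kato_perrin_riou_istar` v8, drafts v9;
stmt-BirchSwinnertonDyer-19945's zp line has no such input and is untouched — its twin audit is Part 56, seat g18).

LEAF AUDIT (v6–v9 istar head = Part 55 ★
`cccOneLawOnTypeIstarZero_of_rowCountOfGZK_of_rowRealizableOfGZK_of_kmcFineContra_of_perrinRiouRatio (hCrows) (hrealRows) (hKMC) (hPR) (h₅) (h₆)`).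
The PURE-CITE stub 6 `stub_printInputsInert : PrintReadingsInert ∧ PublishedFactsInert` feeds two binders.  `h₅ : PrintReadingsInert`
(route item 19226: (C1_η) on the CM good-inert curves, (R2) and the exact Thm-7.4 reading on the type) is consumed IN FULL by
`CccOneLowerHalf.cccOneLawOnTypeIstarZero_of_bsdpOnType` and stays.  `h₆ : PublishedFactsInert` (route item 19227) is the SIX-fold
conjunction `hasEntireLFunction_rat ∧ GrossZagier1986_thm_I_7_3 ∧ rank_eq_analyticRank_of_analyticRank_le_one ∧
poitouTate_selmerStructure_duality_real ℚ ∧ ModularForms.exists_isNewformOf ∧ ModularForms.mazur_not_dvd_maninConstant_of_odd`, and the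
line destructures it at exactly ONE pin (Part 50 §2 / Part 55 §1, `obtain ⟨hmod, -, hGZK, hPT, -, -⟩ := h₆`):
* `GrossZagier1986_thm_I_7_3` (`.2.1`) and `mazur_not_dvd_maninConstant_of_odd` (`.2.2.2.2.2`) are DISCARDED — they serve only the
  FORWARD direction «crux ⟹ `BSD_p` on the type» (`CccOneLowerHalf.cccOneLawOnTypeIstarZero_iff_bsdpOnType`, Mazur's period datum
  `periodRatio_of_mazur`), which the Kato–Perrin-Riou line never takes: the line PRODUCES `BSD_p` per pair (Part 50 §1
  `rankOne_bsdp_of_countAt`) and goes BACKWARD to the crux (`cccOneLawOnTypeIstarZero_of_bsdpOnType h₅ hmod hGZK hPT`);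
* `ModularForms.exists_isNewformOf` (`.2.2.2.2.1`) is DISCARDED here too — the line reads modularity from its own cite stub
  `stub_printFactsKato.2.1`;
* `hasEntireLFunction_rat` (`.1`) is GENUINE at two pins (Part 50 §1 `leadingLCoeff_ne_zero_holds (hmod W)` for `L′(W,1) ≠ 0`;
  `CccOneLowerHalf.valuation_coeff_one_eq_of_bsdp_of_exactControl hmod`) but is a COROLLARY of `ModularForms.exists_isNewformOf`
  (`WeierstrassCurve.hasEntireLFunction_rat_of_exists_isNewformOf`, Diamond–Shurman Thm. 8.8.3 — the same re-keying as Part 56's on zp);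
* `rank_eq_analyticRank_of_analyticRank_le_one` (`.2.2.1`, GZK) and `poitouTate_selmerStructure_duality_real ℚ` (`.2.2.2.1`) are GENUINE
  (the GZK guards of the row count / row realisation; finiteness of Ш and the descent; the exact-control reading).
REPLACEMENT (tree theorems only): the heads below take `(h₅) (hnf : exists_isNewformOf) (hGZK) (hPT)` in place of `(h₅) (h₆)`, every
OTHER binder type BYTE-IDENTICAL to Part 55's (so the registered `rowCount_closed` / `realizable_closed` / `kmcFine_closed` /
`stub_perrinRiouRatioIstarZero` feed them unchanged); conversely Part 55's heads are the new ones applied to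
`(h₆.2.2.2.2.1, h₆.2.2.1, h₆.2.2.2.1)` (kernel-checked in the seat's scratch file; not shipped — the gate's dedup forbids restating them), so
nothing else moves.
HEADS.  §1 (interface binders) `cccOneLawOnTypeIstarZero_of_rowCount_of_rowRealizable_of_perrinRiou_of_modularity (hCrows) (hrealRows)
(hread) (hKMC) (hPR) (h₅) (hnf) (hGZK) (hPT)` = Part 55 §1's with `h₆ ↦ (hnf, hGZK, hPT)`; §2 (closed triple, GZK-guarded) ★★
`cccOneLawOnTypeIstarZero_of_rowCountOfGZK_of_rowRealizableOfGZK_of_kmcFineContra_of_perrinRiouRatio_of_modularity (hCrows) (hrealRows)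
(hKMC) (hPR) (h₅) (hnf) (hGZK) (hPT)` = THE v10 COMPOSITION HEAD.  v10 (planner's touch, if taken): `stub_printInputsInert :
PrintReadingsInert ∧ rank_eq_analyticRank_of_analyticRank_le_one ∧ poitouTate_selmerStructure_duality_real ℚ` (two named facts + the
route item 19226, instead of 19226 ∧ the six-fold 19227); composition `:= <§2 head> rowCount_closed realizable_closed (kmcFine_closed ·)
(stub_perrinRiouRatioIstarZero ·) stub_printInputsInert.1 stub_printFactsKato.2.1 stub_printInputsInert.2.1 stub_printInputsInert.2.2`.
READING OF RECORD after this file (19223 via the KPR line): RESEARCH {PR^× on the rows, μ-equality at (p)} ∪ PRINT {H2X′,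
`exists_isNewformOf`, F-CM, BT26 Thm. 2.6, `PrintReadingsInert` (19226), GZK, Poitou–Tate} — `GrossZagier1986_thm_I_7_3`,
`mazur_not_dvd_maninConstant_of_odd` and `hasEntireLFunction_rat` are OUT of this cone (they stay the tree's named facts and the
route's items, merely unused here; the route's other theses and the forward direction still use them).
HONEST LABEL: every statement is CONDITIONAL on displayed hypotheses; the crux is concluded BY NAME, never restated; 19223 stays OPEN;
no stub is closed on the ledger; X12.CMInertBad is NOT proved; no summit statement is proved by this seat; BSD is not proved for any curve.
[cite: BurnsKuriharaSano2019, Thm. 7.3 and Thm. 7.6 (p. 29), Conj. 2.8 (p. 10)] [cite: Kato2004Asterisque, Conj. 12.10 (p. 224), §14.14 (p. 243)]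
[cite: Kobayashi2003, §4 (p. 8), Thm. 7.4 (p. 13)] [cite: DiamondShurman2005, Thm. 8.8.3] [cite: BreuilConradDiamondTaylor2001, Thm. A]
[cite: GrossZagier1986, Thm. I.(7.3) (p. 231)] [cite: Mazur1978, Cor. 4.1]
-/

noncomputable section

open scoped Classical NumberField

open WeierstrassCurve Literature.NumberTheory.EllipticCurves
  Literature.NumberTheory.EllipticCurves.ModularForms
  Literature.NumberTheory.EllipticCurves.Rank1Residual
  Literature.NumberTheory.EllipticCurves.Rank1Residual.Typed
  Literature.NumberTheory.EllipticCurves.IwasawaAlgebra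
  Literature.NumberTheory.GaloisCohomology
open Summit.BirchSwinnertonDyer.Rank1Residual
open Summit.BirchSwinnertonDyer.Rank1Residual.Additive
open Summit.BirchSwinnertonDyer.Rank1Residual.X12.O10
open Summit.BirchSwinnertonDyer.BirchSwinnertonDyer.Theses.InertBadSignedBranches
open Summit.BirchSwinnertonDyer.BirchSwinnertonDyer.Theorems
open Summit.BirchSwinnertonDyer.BirchSwinnertonDyer.Theorems.CccOneLowerHalf

namespace Summit.BirchSwinnertonDyer.Rank1Residual.Additive.KMCImpReadingPointwise

/-! ## §1 Crux 19223 BY NAME from a row-keyed count AND a row-keyed realisation, over the interface binders, with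
`PublishedFactsInert` cut to (modularity, GZK, Poitou–Tate) -/

section RowKeyed

variable {IsOf : ∀ (W : WeierstrassCurve ℚ) [W.IsElliptic] [W.IsGloballyMinimal] (p : ℕ) [Fact p.Prime],
  KatoDescentDatum p → Prop}
variable {PRRatio : ∀ (W : WeierstrassCurve ℚ) [W.IsElliptic] [W.IsGloballyMinimal] (p : ℕ)
  [Fact p.Prime], ℚ_[p] → Prop}
variable {KMC : ∀ (W : WeierstrassCurve ℚ) [W.IsElliptic] [W.IsGloballyMinimal] (p : ℕ), Prop}

/-- **Crux 19223 `CccOneLawOnTypeIstarZero` ⟸ KMC(T_pW) ∧ PR^×(W, p) at every rank-one pair of the type `(p, I₀*)`, `p ≥ 5`, count AND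
realisation keyed TO THE ROWS, the published inputs BY NAME** — Part 55 §1
`cccOneLawOnTypeIstarZero_of_rowCount_of_rowRealizable_of_perrinRiou` with `h₆ : PublishedFactsInert` replaced by the three inputs the
line consumes: modularity `hnf` (giving the entire `L`-function by `hasEntireLFunction_rat_of_exists_isNewformOf`), GZK `hGZK` and
Poitou–Tate `hPT`; every other binder type identical.  Per pair: Part 50 §1 `rankOne_bsdp_of_countAt`, then
`cccOneLawOnTypeIstarZero_of_bsdpOnType`.  The crux is concluded BY NAME.  CONDITIONAL; 19223 stays OPEN.
[cite: BurnsKuriharaSano2019, Thm. 7.6 (p. 29)] [cite: Kato2004Asterisque, Conj. 12.10 (p. 224), §15] [cite: Kobayashi2003, §4 (p. 8), Thm. 7.4 (p. 13)]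
[cite: DiamondShurman2005, Thm. 8.8.3] -/
theorem cccOneLawOnTypeIstarZero_of_rowCount_of_rowRealizable_of_perrinRiou_of_modularity
    (hCrows : ∀ (p : ℕ) [Fact p.Prime], 5 ≤ p → ∀ (W : WeierstrassCurve ℚ) [W.IsElliptic] [W.IsGloballyMinimal],
      HasSignedLocalType W p (.Istar 0) → W.analyticRank = 1 →
      ∀ (D : KatoDescentDatum p) (ℒ : ℚ_[p]), IsOf W p D → PRRatio W p ℒ →
        Finite (coinvariants p D.H2) ∧ (ℒ ≠ 0 ↔ D.zetaIndex ≠ 0) ∧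
          ∀ m : ℕ, D.zetaIndex = p ^ m * D.h2Card →
            ℒ.valuation = (m : ℤ) +
              padicValNat p (Nat.card (AddCommGroup.primaryComponent W.sha p)) +
              padicValNat p W.tamagawaProduct)
    (hrealRows : ∀ (p : ℕ) [Fact p.Prime], 5 ≤ p → ∀ (W : WeierstrassCurve ℚ) [W.IsElliptic] [W.IsGloballyMinimal],
      HasSignedLocalType W p (.Istar 0) → W.analyticRank = 1 → KMC W p → ∃ D : KatoDescentDatum p, IsOf W p D)
    (hread : ∀ (W : WeierstrassCurve ℚ) [W.IsElliptic] [W.IsGloballyMinimal] (p : ℕ) [Fact p.Prime]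
      (D : KatoDescentDatum p), IsOf W p D → KMC W p → D.Conj1210)
    (hKMC : ∀ (p : ℕ) [Fact p.Prime], 5 ≤ p → ∀ (W : WeierstrassCurve ℚ) [W.IsElliptic]
      [W.IsGloballyMinimal], HasSignedLocalType W p (.Istar 0) → W.analyticRank = 1 → KMC W p)
    (hPR : ∀ (p : ℕ) [Fact p.Prime], 5 ≤ p → ∀ (W : WeierstrassCurve ℚ) [W.IsElliptic]
      [W.IsGloballyMinimal], HasSignedLocalType W p (.Istar 0) → W.analyticRank = 1 →
      PerrinRiouUpToUnitAt PRRatio W p)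
    (h₅ : PrintReadingsInert) (hnf : exists_isNewformOf)
    (hGZK : rank_eq_analyticRank_of_analyticRank_le_one) (hPT : poitouTate_selmerStructure_duality_real ℚ) :
    CccOneLawOnTypeIstarZero := by
  have hmod : hasEntireLFunction_rat := hasEntireLFunction_rat_of_exists_isNewformOf hnf
  refine cccOneLawOnTypeIstarZero_of_bsdpOnType h₅ hmod hGZK hPT fun p _ hp5 W _ _ hT hr ↦ ?_
  obtain ⟨-, -, htors⟩ :=
    CccOneKMCPerrinRiou.addv_and_j_nonneg_and_not_dvd_torsionOrder_of_hasSignedLocalType W p (by omega) hT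
  exact rankOne_bsdp_of_countAt W p (hCrows p hp5 W hT hr) (fun hK ↦ hrealRows p hp5 W hT hr hK) hread hGZK hmod hr htors
    (hPR p hp5 W hT hr) (hKMC p hp5 W hT hr)

end RowKeyed

/-! ## §2 At the PRINT-EXACT closed triple, GZK-guarded: the v10 composition head -/

section Closed

/-- ★★ **Crux 19223 BY NAME from a ROW-KEYED stub 3 and a ROW-KEYED stub 4, both GUARDED BY GZK, the published inputs BY NAME** —
Part 55 ★ `cccOneLawOnTypeIstarZero_of_rowCountOfGZK_of_rowRealizableOfGZK_of_kmcFineContra_of_perrinRiouRatio` with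
`h₆ : PublishedFactsInert` replaced by `(hnf : exists_isNewformOf) (hGZK) (hPT)`; `hCrows`, `hrealRows`, `hKMC`, `hPR`, `h₅` BYTE-IDENTICAL
to Part 55's (= the registered `rowCount_closed` / `realizable_closed` / `kmcFine_closed` / `stub_perrinRiouRatioIstarZero` types); the
`→`-only reading discharged by `conj1210_of_isKatoZetaDescentDatumOfContra_of_katoMainConjectureFineContra` (p628155).  Intended as the
composition term of a v10 istar skeleton whose cite stub 6 reads `PrintReadingsInert ∧ rank_eq_analyticRank_of_analyticRank_le_one ∧
poitouTate_selmerStructure_duality_real ℚ` (this file registers nothing).  CONDITIONAL; 19223 stays OPEN; BSD is not proved.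
[cite: BurnsKuriharaSano2019, Thm. 7.6 (p. 29), Conj. 2.8 (ii) (p. 10)] [cite: Kato2004Asterisque, Conj. 12.10 (p. 224), §14.14 (p. 243)]
[cite: Kobayashi2003, §4 (p. 8), Thm. 7.4 (p. 13)] [cite: DiamondShurman2005, Thm. 8.8.3] -/
theorem cccOneLawOnTypeIstarZero_of_rowCountOfGZK_of_rowRealizableOfGZK_of_kmcFineContra_of_perrinRiouRatio_of_modularity
    (hCrows : rank_eq_analyticRank_of_analyticRank_le_one →
      ∀ (p : ℕ) [Fact p.Prime], 5 ≤ p → ∀ (W : WeierstrassCurve ℚ) [W.IsElliptic] [W.IsGloballyMinimal],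
      HasSignedLocalType W p (.Istar 0) → W.analyticRank = 1 →
      ∀ (D : KatoDescentDatum p) (ℒ : ℚ_[p]),
        IsKatoZetaDescentDatumOfContra W p D → Kato2004.PRRatio W p ℒ →
        Finite (coinvariants p D.H2) ∧ (ℒ ≠ 0 ↔ D.zetaIndex ≠ 0) ∧
          ∀ m : ℕ, D.zetaIndex = p ^ m * D.h2Card →
            ℒ.valuation = (m : ℤ) +
              padicValNat p (Nat.card (AddCommGroup.primaryComponent W.sha p)) +
              padicValNat p W.tamagawaProduct)
    (hrealRows : rank_eq_analyticRank_of_analyticRank_le_one →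
      ∀ (p : ℕ) [Fact p.Prime], 5 ≤ p → ∀ (W : WeierstrassCurve ℚ) [W.IsElliptic] [W.IsGloballyMinimal],
      HasSignedLocalType W p (.Istar 0) → W.analyticRank = 1 →
      KatoMainConjectureFineContra W p → ∃ D : KatoDescentDatum p, IsKatoZetaDescentDatumOfContra W p D)
    (hKMC : ∀ (p : ℕ) [Fact p.Prime], 5 ≤ p → ∀ (W : WeierstrassCurve ℚ) [W.IsElliptic]
      [W.IsGloballyMinimal], HasSignedLocalType W p (.Istar 0) → W.analyticRank = 1 →
      KatoMainConjectureFineContra W p)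
    (hPR : ∀ (p : ℕ) [Fact p.Prime], 5 ≤ p → ∀ (W : WeierstrassCurve ℚ) [W.IsElliptic]
      [W.IsGloballyMinimal], HasSignedLocalType W p (.Istar 0) → W.analyticRank = 1 →
      PerrinRiouUpToUnitAt Kato2004.PRRatio W p)
    (h₅ : PrintReadingsInert) (hnf : exists_isNewformOf)
    (hGZK : rank_eq_analyticRank_of_analyticRank_le_one) (hPT : poitouTate_selmerStructure_duality_real ℚ) :
    CccOneLawOnTypeIstarZero :=
  cccOneLawOnTypeIstarZero_of_rowCount_of_rowRealizable_of_perrinRiou_of_modularity (hCrows hGZK) (hrealRows hGZK)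
    (fun _ _ _ _ _ _ hD hK ↦ conj1210_of_isKatoZetaDescentDatumOfContra_of_katoMainConjectureFineContra hD hK)
    hKMC hPR h₅ hnf hGZK hPT

end Closed

end Summit.BirchSwinnertonDyer.Rank1Residual.Additive.KMCImpReadingPointwise

end
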